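import Summits.Schanuel.Schanuel.Theorems.RootDecomp1KThueMahler01

/-!
# RootDecomp1KThueMahler — lens 1, generation 56, NODE 16 «THUE–MAHLER ON THE LINE» (RULE K-R46 payable clause; CLAIM L2656, PRICE L2660) — continuation (RootDecomp1KThueMahler02): §5 the theorem (finite_dyadicPts, levelFinite_xLinear_sep3, thinFibreAt_xLinear_sep3, XLinTM), §6 the odd-part lever by name

(lens-1 g56 NODE 16 HOME kernel K = HOME/decomp-schanuel-lens-1/g56/ThueMahler.lean d10a59d7…, 957 l, 92 thm + 7 def, imports tree …RootDecomp1KIntegrality04 ONLY (no Literature import, no fact def, no private / set_option); Probe / Ctrl0 / Ctrl + NODE-g56.md + presearch_g56.txt + SHA256SUMS; CLAIM L2656, census LIVENESS-v5 node-16 rows L2657 (of record L2661 (A)), crit EX-ANTE PRICE L2660 (ONE THEOREM ×1 under K-R46's payable clause «an infinite class of AMENDED-FRONTIER pairs made unconditional by an input outside the toolkit of record» iff CHECKLIST K-g56; hand check of the Thue–Mahler mechanism SOUND), crit RULING L2661 (B) (L17P ERRATUM of record: `L17P = normShapeCurve (−(Y+3)) (Y²−17) 1 1` is LEVEL-FINITE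 hyp-free by node 10), NODE L2664, critic VERDICT L2665: CLEARED — THEOREM ×1 under K-R46's payable clause (EX-ANTE PRICE L2660), CHECKLIST K-g56 (1)–(10) MET; erratum §9 = ×0 bookkeeping as RULED L2661 (B); RULE K-R47 FIXED (toolkit of record ∪ {multi-form elimination at the odd places (`exists_resultant_bound`, two charts), archimedean floor (`exists_arch_floor`), product-formula transfer (`abs_mul_norm_le_of_odd_part`, `hform_eq_prod`), height-fed Ridout/Liouville closing}; FRONTIER re-amended by «NOT LEVEL-FINITE by the {2, ∞} Thue–Mahler reduction (XLinTM)»; open territory of record at m₀ = 2 := x-degree ≥ 2 members with |J_D| ≥ 2 or J_D = {j₀ ≥ 1} (M17P the standing witness) ∪ x-linear pairs outside XLinTM); PORT GO (K verbatim; docstrings/provenance only; «cite-token» spelling incl. «Mahler1933»; dedup 0) — census STAGING NOTE 6 L2667, crit ACK L2668 (staging sanctioned; identity-diff expectation identical 98 · MOD 3 · differ 0). Port by census-1 gen 22 as `RootDecomp1KThueMahler01–04` (`--supports stmt-Schanuel-33364`; no census credit): 01 = §1 COPRIMALITY (no common root, the two charts, the RESULTANT BOUND on common divisors of the binary forms)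 + §2 THE ODD PART (`|F|·‖F‖₂ ≤ |d₀|`) + §3 THE ARCHIMEDEAN FLOOR + §4 the bounded dyadic points `DyadicPt A B M r`, the integers `F_A`, `F_B` and the `2`-adic side; 02 = §5 THE THEOREM **`finite_dyadicPts`** (Thue–Mahler on the line: finitely many bounded dyadic points), **`levelFinite_xLinear_sep3 : LevelFinite (xLinP A B)`** and **`thinFibreAt_xLinear_sep3 : ThinFibreAt m₀ (xLinP A B)` for EVERY `m₀`** (B separable over ℚ, `3 ≤ deg B`, `deg A ≤ deg B`, `A ⊥ B`), the class predicate **`XLinTM P`**, `levelFinite_of_xLinTM` + §6 the odd-part lever by name `odd_dvd_resultant_of_onLevel` (Mahler 1933); 03 = §7 the x-linear presentation toolkit (`linC`, `xdeg_xLinP`, …) and the TERRITORY certificates by tree names; 04 = §8 the members **`L17C = (Y+3) + x(Y³−17)`**, **`E17C = (Y³+3) + x(Y³−17)`** and the infinite family **`LD17 D = (Y+3) + x(Y^D − 17)`, `D ≥ 3`** (`thinFibreAt_LD17` hyp-free, every `m₀`; `¬ DecidedAt 2`, `¬ LocalAt 2`, `¬ GaussAt`, `¬ HeightDecidedAt 2`,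 not of norm shape, `3 ≤ thinThreshold`) + §9 ERRATUM OF RECORD `L17P_eq_normShapeCurve` / `normShapeHyp_L17P` / `thinFibreAt_L17P_all` (hyp-free by node 10; ×0) + §10 sharpness and costume arithmetic. PORT EDITS: THREE one-line helpers PRIVATISED (file-local copies where used in a later part) — K's `isCoprime_num_den` (public twin `Literature.…SparseDyadicRationals.isCoprime_num_den` outside the import closure; private copies already in LevelFinite03/04/08/09), `isCoprime_two_pow_of_odd'` and `norm_intCast_Cp_le_one` (head dry-run dedup.foreign: print like BirchSwinnertonDyer decls) —; 30 one-line docstrings on undocumented computation lemmas of §7–§9 (statements quoted); otherwise none (no dedup.landed twin, no set_option, no cite-token in a def docstring); provenance doc blocks + continuation headers = K's own open-lines; statements and proofs VERBATIM. Rung 0 — nothing here proves Schanuel, 33364, 33363, 31077 or ThinFibre 2; the class, the members and the family are HYPOTHESIS-FREE (the one external theorem used is the tree's proved `ridout_window_pow`).)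
-/

noncomputable section

namespace Summit.Schanuel.Schanuel.Theorems.RootDecomp1KThueMahler

open Polynomial LiouvilleNumber
open scoped Nat
open Summit.Schanuel.Schanuel.Theorems.RootDecomp1KTwoBaseCell (psNumer)
open Summit.Schanuel.Schanuel.Theorems.RootDecomp1KDegreeLadder
open Summit.Schanuel.Schanuel.Theorems.RootDecomp1KXLinear
open Summit.Schanuel.Schanuel.Theorems.RootDecomp1KXLinearII
open Summit.Schanuel.Schanuel.Theorems.RootDecomp1KXAll
open Summit.Schanuel.Schanuel.Theorems.RootDecomp1KLevelFinite
open Summit.Schanuel.Schanuel.Theorems.RootDecomp1KSubspaceBranch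
open Summit.Schanuel.Schanuel.Theorems.RootDecomp1KXTop
open Summit.Schanuel.Schanuel.Theorems.RootDecomp1KLocalExponent
open Summit.Schanuel.Schanuel.Theorems.RootDecomp1KIntegrality
open Summit.Schanuel.Schanuel.Theorems.RootDecomp1KHeightGrading
open Summit.Schanuel.Schanuel.Theorems.RootDecomp1KHeightMachine

/-- an odd integer is coprime to every power of `2`. -/
private theorem isCoprime_two_pow_of_odd' {o : ℤ} (ho : Odd o) (e : ℕ) : IsCoprime o ((2 : ℤ) ^ e) := by
  obtain ⟨j, hj⟩ := ho
  have h : IsCoprime o (2 : ℤ) := ⟨1, -j, by rw [hj]; ring⟩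
  exact h.pow_right

/-- `num r ⊥ den r` as integers. -/
private theorem isCoprime_num_den (r : ℚ) : IsCoprime r.num (r.den : ℤ) := by
  rw [Int.isCoprime_iff_gcd_eq_one]
  have := r.reduced
  simpa [Int.gcd] using this

/-! ## §5  THE THEOREM: FINITELY MANY BOUNDED DYADIC POINTS (Thue–Mahler on the line), LEVEL FINITENESS, EVERY `m₀` -/

/-- **THUE–MAHLER ON THE LINE.**  `B` separable over `ℚ`, `deg B ≥ 3`, `deg A ≤ deg B`, `A ⊥ B`: the bounded dyadic points
`r` (`|r| ≤ C`, `B(r) ≠ 0`, `A(r)/B(r) ∈ ℤ[1/2]` with `|A(r)/B(r)| ≤ M`) form a FINITE set. -/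
theorem finite_dyadicPts (A B : ℤ[X]) (hsep : (B.map (Int.castRingHom ℚ)).Separable) (hn : 3 ≤ B.natDegree)
    (hle : A.natDegree ≤ B.natDegree) (hcop : IsCoprime (A.map (Int.castRingHom ℚ)) (B.map (Int.castRingHom ℚ)))
    (C M : ℝ) : {r : ℚ | |(r : ℝ)| ≤ C ∧ DyadicPt A B M r}.Finite := by
  classical
  have hB0 : B ≠ 0 := by rintro rfl; simp at hn
  have hb : 1 ≤ B.natDegree := by omega
  have hn0 : B.natDegree ≠ 0 := by omega
  have hBn : B.coeff B.natDegree ≠ 0 := by rw [coeff_natDegree]; exact leadingCoeff_ne_zero.mpr hB0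
  obtain ⟨d₀, hd₀, hres⟩ := exists_resultant_bound A B hle le_rfl hBn hcop
  obtain ⟨c₀, hc₀, hfloor⟩ := exists_arch_floor A B hcop C M
  obtain ⟨T, c, hc, hcard, hTroots, hprod, hnear⟩ := nearest_root B hb hsep
  have hℓpos : 0 < ‖(B.leadingCoeff : PadicAlgCl 2)‖ := by
    rw [norm_pos_iff]; exact_mod_cast leadingCoeff_ne_zero.mpr hB0
  -- the constants (kept opaque)
  obtain ⟨MT, hMT⟩ : ∃ MT : ℝ, MT = 1 + ∑ β ∈ T, ‖β‖ := ⟨_, rfl⟩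
  have hMT1 : 1 ≤ MT := by
    have : 0 ≤ ∑ β ∈ T, ‖β‖ := Finset.sum_nonneg fun β _ => norm_nonneg β
    linarith
  have hMTpos : 0 < MT := by linarith
  have hβMT : ∀ β ∈ T, ‖β‖ < MT := by
    intro β hβ
    have := Finset.single_le_sum (fun β _ => norm_nonneg β) hβ
    linarith
  obtain ⟨δ, hδ⟩ : ∃ δ : ℝ, δ = 1 / (2 * MT) := ⟨_, rfl⟩
  have hδpos : 0 < δ := by rw [hδ]; exact div_pos one_pos (by linarith)
  have hδ1 : δ < 1 := by
    rw [hδ, div_lt_one (by linarith : (0 : ℝ) < 2 * MT)]; linarith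
  have hMTδ : MT * δ = 1 / 2 := by rw [hδ]; field_simp
  obtain ⟨D₁, hD₁⟩ : ∃ D₁ : ℝ, D₁ = |(d₀ : ℝ)| / (c₀ * ‖(B.leadingCoeff : PadicAlgCl 2)‖) := ⟨_, rfl⟩
  obtain ⟨K₁, hK₁⟩ : ∃ K₁ : ℝ, K₁ = |(d₀ : ℝ)| / (c₀ * δ ^ B.natDegree) := ⟨_, rfl⟩
  obtain ⟨K₂, hK₂⟩ : ∃ K₂ : ℝ, K₂ = max 1 (‖(B.leadingCoeff : PadicAlgCl 2)‖ * c * K₁) := ⟨_, rfl⟩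
  have hK₂1 : 1 ≤ K₂ := by rw [hK₂]; exact le_max_left _ _
  have hK₂ge : ‖(B.leadingCoeff : PadicAlgCl 2)‖ * c * K₁ ≤ K₂ := by rw [hK₂]; exact le_max_right _ _
  have hfin₁ := finite_rat_of_abs_le_den_le C (max D₁ (K₂ ^ 2))
  have hfin₂ := ridout_window_pow B hb C (2 * B.natDegree - 1) 2 (by norm_num) (by omega)
  refine (hfin₁.union hfin₂).subset ?_
  rintro r ⟨hrC, hpt⟩
  by_cases hsmall : (r.den : ℝ) ≤ max D₁ (K₂ ^ 2)
  · exact Or.inl ⟨hrC, hsmall⟩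
  right
  have hbig : max D₁ (K₂ ^ 2) < r.den := lt_of_not_ge hsmall
  have hdenD₁ : D₁ < r.den := lt_of_le_of_lt (le_max_left _ _) hbig
  have hdenK : K₂ ^ 2 < r.den := lt_of_le_of_lt (le_max_right _ _) hbig
  have hden1 : (1 : ℝ) < r.den := lt_of_le_of_lt (by nlinarith) hdenK
  have hdenpos : (0 : ℝ) < r.den := by linarith
  have hr0 : r ≠ 0 := by
    rintro rfl
    simp at hden1
  obtain ⟨hBr, s, e, hs, hrel⟩ := hpt
  -- the integers `F_A`, `F_B`
  have hFB0 : hform B.coeff B.natDegree r.num (r.den : ℤ) ≠ 0 := hform_ne_zero_of_aeval le_rfl hBr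
  have hrelF : (2 : ℤ) ^ e * hform A.coeff B.natDegree r.num (r.den : ℤ) +
      s * hform B.coeff B.natDegree r.num (r.den : ℤ) = 0 := hform_rel hle le_rfl hrel
  have hdiv : ∀ m : ℤ, Odd m → m ∣ hform A.coeff B.natDegree r.num (r.den : ℤ) →
      m ∣ hform B.coeff B.natDegree r.num (r.den : ℤ) → m ∣ d₀ := fun m _ hmA hmB =>
    hres r.num r.den (Rat.num_ne_zero.mpr hr0) (by exact_mod_cast r.den_nz) (isCoprime_num_den r) m hmA hmB
  have hprodle := abs_mul_norm_le_of_odd_part hFB0 hd₀ hrelF hdiv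
  -- the floor: `|F_B| ≥ c₀·denⁿ`, hence `‖F_B‖₂ ≤ |d₀| / (c₀·denⁿ)`
  have hfl : c₀ ≤ |aeval (r : ℝ) B| := hfloor r hrC (abs_aeval_le_of_dyadicPt ⟨hBr, s, e, hs, hrel⟩)
  have hFBge : c₀ * (r.den : ℝ) ^ B.natDegree ≤ |((hform B.coeff B.natDegree r.num (r.den : ℤ) : ℤ) : ℝ)| := by
    rw [abs_hform_eq le_rfl r, mul_comm]
    exact mul_le_mul_of_nonneg_left hfl (pow_nonneg hdenpos.le _)
  have hcden : 0 < c₀ * (r.den : ℝ) ^ B.natDegree := mul_pos hc₀ (pow_pos hdenpos _)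
  have hnormFB : ‖((hform B.coeff B.natDegree r.num (r.den : ℤ) : ℤ) : PadicAlgCl 2)‖ ≤
      |(d₀ : ℝ)| / (c₀ * (r.den : ℝ) ^ B.natDegree) := by
    rw [le_div_iff₀ hcden]
    calc ‖((hform B.coeff B.natDegree r.num (r.den : ℤ) : ℤ) : PadicAlgCl 2)‖ * (c₀ * (r.den : ℝ) ^ B.natDegree)
          ≤ ‖((hform B.coeff B.natDegree r.num (r.den : ℤ) : ℤ) : PadicAlgCl 2)‖ *
            |((hform B.coeff B.natDegree r.num (r.den : ℤ) : ℤ) : ℝ)| :=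
          mul_le_mul_of_nonneg_left hFBge (norm_nonneg _)
      _ = _ := mul_comm _ _
      _ ≤ |(d₀ : ℝ)| := hprodle
  -- the 2-adic denominator is not small: `‖den‖₂ ≥ δ` (else `num` odd, every factor `num − β·den` a unit, `‖F_B‖₂ = ‖lc‖`)
  have hcast_den : ((r.den : ℕ) : PadicAlgCl 2) = ((r.den : ℤ) : PadicAlgCl 2) := by push_cast; rfl
  have hdenδ : δ ≤ ‖((r.den : ℤ) : PadicAlgCl 2)‖ := by
    by_contra hlt
    have hlt' : ‖((r.den : ℤ) : PadicAlgCl 2)‖ < δ := lt_of_not_ge hlt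
    have h2den : (2 : ℤ) ∣ (r.den : ℤ) := two_dvd_of_norm_lt_one (hlt'.trans hδ1)
    have hnum1 : ‖(r.num : PadicAlgCl 2)‖ = 1 := norm_eq_one_of_not_two_dvd (not_two_dvd_num h2den)
    have hfac : ∀ β ∈ T, ‖(r.num : PadicAlgCl 2) - β * (r.den : PadicAlgCl 2)‖ = 1 := by
      intro β hβ
      have hlt1 : ‖β * (r.den : PadicAlgCl 2)‖ < 1 := by
        rw [norm_mul, hcast_den]
        calc ‖β‖ * ‖((r.den : ℤ) : PadicAlgCl 2)‖ ≤ MT * δ :=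
              mul_le_mul (hβMT β hβ).le hlt'.le (norm_nonneg _) hMTpos.le
          _ = 1 / 2 := hMTδ
          _ < 1 := by norm_num
      have hne : ‖(r.num : PadicAlgCl 2)‖ ≠ ‖-(β * (r.den : PadicAlgCl 2))‖ := by
        rw [norm_neg, hnum1]; exact ne_of_gt hlt1
      rw [sub_eq_add_neg, IsUltrametricDist.norm_add_eq_max_of_norm_ne_norm hne, norm_neg, hnum1,
        max_eq_left hlt1.le]
    have hnFB : ‖((hform B.coeff B.natDegree r.num (r.den : ℤ) : ℤ) : PadicAlgCl 2)‖ =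
        ‖(B.leadingCoeff : PadicAlgCl 2)‖ := by
      rw [hform_eq_prod hcard hprod r, norm_mul, norm_prod, Finset.prod_eq_one (fun β hβ => hfac β hβ), mul_one]
    have h1 := hnormFB
    rw [hnFB, le_div_iff₀ hcden] at h1
    have h2 : (r.den : ℝ) ≤ (r.den : ℝ) ^ B.natDegree := le_self_pow₀ hden1.le hn0
    have h3 : ‖(B.leadingCoeff : PadicAlgCl 2)‖ * (c₀ * (r.den : ℝ)) ≤ |(d₀ : ℝ)| :=
      le_trans (mul_le_mul_of_nonneg_left (mul_le_mul_of_nonneg_left h2 hc₀.le) (norm_nonneg _)) h1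
    have h4 : (r.den : ℝ) ≤ D₁ := by
      rw [hD₁, le_div_iff₀ (mul_pos hc₀ hℓpos)]; linarith [h3]
    linarith
  -- 2-adic closeness with the HEIGHT exponent: `‖B(r)‖₂ ≤ K₁/denⁿ`, `‖lc·(r − β)‖₂ ≤ K₂/denⁿ`
  have hBrC : ‖aeval (r : PadicAlgCl 2) B‖ ≤ K₁ / (r.den : ℝ) ^ B.natDegree := by
    have h1 : ‖((hform B.coeff B.natDegree r.num (r.den : ℤ) : ℤ) : PadicAlgCl 2)‖ =
        ‖((r.den : ℤ) : PadicAlgCl 2)‖ ^ B.natDegree * ‖aeval (r : PadicAlgCl 2) B‖ := by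
      rw [hform_cast_Cp le_rfl r, norm_mul, norm_pow, hcast_den]
    have hdn : δ ^ B.natDegree ≤ ‖((r.den : ℤ) : PadicAlgCl 2)‖ ^ B.natDegree :=
      pow_le_pow_left₀ hδpos.le hdenδ _
    have h2 : ‖aeval (r : PadicAlgCl 2) B‖ * δ ^ B.natDegree ≤ |(d₀ : ℝ)| / (c₀ * (r.den : ℝ) ^ B.natDegree) := by
      calc ‖aeval (r : PadicAlgCl 2) B‖ * δ ^ B.natDegree
            ≤ ‖aeval (r : PadicAlgCl 2) B‖ * ‖((r.den : ℤ) : PadicAlgCl 2)‖ ^ B.natDegree :=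
            mul_le_mul_of_nonneg_left hdn (norm_nonneg _)
        _ = ‖((hform B.coeff B.natDegree r.num (r.den : ℤ) : ℤ) : PadicAlgCl 2)‖ := by rw [h1, mul_comm]
        _ ≤ _ := hnormFB
    have h3 := (le_div_iff₀ (pow_pos hδpos B.natDegree)).mpr h2
    refine h3.trans (le_of_eq ?_)
    rw [hK₁, div_div, div_div, mul_right_comm]
  obtain ⟨β, hβT, hβ⟩ := hnear (r : PadicAlgCl 2)
  have hclose : ‖(B.leadingCoeff : PadicAlgCl 2) * ((r : PadicAlgCl 2) - β)‖ ≤ K₂ / (r.den : ℝ) ^ B.natDegree := by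
    rw [norm_mul]
    have hdn : (0 : ℝ) < (r.den : ℝ) ^ B.natDegree := pow_pos hdenpos _
    calc ‖(B.leadingCoeff : PadicAlgCl 2)‖ * ‖(r : PadicAlgCl 2) - β‖
          ≤ ‖(B.leadingCoeff : PadicAlgCl 2)‖ * (c * (K₁ / (r.den : ℝ) ^ B.natDegree)) :=
          mul_le_mul_of_nonneg_left (hβ.trans (mul_le_mul_of_nonneg_left hBrC hc.le)) (norm_nonneg _)
      _ = (‖(B.leadingCoeff : PadicAlgCl 2)‖ * c * K₁) / (r.den : ℝ) ^ B.natDegree := by ring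
      _ ≤ K₂ / (r.den : ℝ) ^ B.natDegree := div_le_div_of_nonneg_right hK₂ge hdn.le
  -- the Ridout inequality with exponent `(2n − 1)/2 > 2`
  refine ⟨hrC, β, hTroots β hβT, ?_⟩
  have hK₂0 : 0 ≤ K₂ / (r.den : ℝ) ^ B.natDegree := div_nonneg (by linarith) (pow_nonneg hdenpos.le _)
  have hpow : ((r.den : ℝ) ^ B.natDegree) ^ 2 = (r.den : ℝ) * (r.den : ℝ) ^ (2 * B.natDegree - 1) := by
    rw [← pow_mul, ← pow_succ']; congr 1; omega
  have e1 : (r.den : ℝ) ^ (2 * B.natDegree - 1) * (K₂ / (r.den : ℝ) ^ B.natDegree) ^ 2 = K₂ ^ 2 / r.den := by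
    rw [div_pow, hpow, mul_div_assoc', mul_comm ((r.den : ℝ) ^ (2 * B.natDegree - 1)) (K₂ ^ 2),
      mul_div_mul_right _ _ (pow_ne_zero _ hdenpos.ne')]
  calc (r.den : ℝ) ^ (2 * B.natDegree - 1) * ‖(B.leadingCoeff : PadicAlgCl 2) * ((r : PadicAlgCl 2) - β)‖ ^ 2
        ≤ (r.den : ℝ) ^ (2 * B.natDegree - 1) * (K₂ / (r.den : ℝ) ^ B.natDegree) ^ 2 :=
        mul_le_mul_of_nonneg_left (pow_le_pow_left₀ (norm_nonneg _) hclose 2) (pow_nonneg hdenpos.le _)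
    _ = K₂ ^ 2 / r.den := e1
    _ ≤ 1 := by rw [div_le_one hdenpos]; exact hdenK.le

/-- a level point `(s_N, r)` with `B(r) ≠ 0` is a bounded dyadic point with `M = 2` (`p_N < 2·2^{N!}`). -/
theorem dyadicPt_of_onLevel {A B : ℤ[X]} {N : ℕ} {r : ℚ} (h : OnLevel A B N r) (hBr : aeval r B ≠ 0) :
    DyadicPt A B 2 r := by
  refine ⟨hBr, (psNumer 2 N : ℤ), N !, ?_, ?_⟩
  · have h1 := psNumer_lt N
    have h2 : ((psNumer 2 N : ℕ) : ℝ) < 2 * 2 ^ N ! := by exact_mod_cast h1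
    rw [Int.cast_natCast, abs_of_nonneg (by positivity)]
    exact h2.le
  · unfold OnLevel at h
    have h2 : (2 : ℚ) ^ N ! ≠ 0 := by positivity
    have key : (2 : ℚ) ^ N ! * (aeval r A + (psNumer 2 N : ℚ) / 2 ^ N ! * aeval r B) =
        (2 : ℚ) ^ N ! * aeval r A + ((psNumer 2 N : ℤ) : ℚ) * aeval r B := by
      push_cast
      field_simp
    rw [← key, h, mul_zero]

/-- **LEVEL FINITENESS of the x-linear curve `A(Y) + x·B(Y)`** (`B` separable, `deg B ≥ 3`, `deg A ≤ deg B`, `A ⊥ B`),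
HYPOTHESIS-FREE. -/
theorem levelFinite_xLinear_sep3 (A B : ℤ[X]) (hsep : (B.map (Int.castRingHom ℚ)).Separable) (hn : 3 ≤ B.natDegree)
    (hle : A.natDegree ≤ B.natDegree) (hcop : IsCoprime (A.map (Int.castRingHom ℚ)) (B.map (Int.castRingHom ℚ))) :
    LevelFinite (xLinP A B) := by
  intro C
  have hfin := finite_dyadicPts A B hsep hn hle hcop C 2
  have hbad : (⋃ r ∈ {r : ℚ | |(r : ℝ)| ≤ C ∧ DyadicPt A B 2 r}, {N : ℕ | OnLevel A B N r}).Finite :=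
    hfin.biUnion fun r hr => levels_finite_of_B_ne hr.2.1
  refine hbad.subset ?_
  rintro N ⟨r, hrC, hP, hnd⟩
  have hpt : OnLevel A B N r := onLevel_of_bev hP
  have hBr : aeval r B ≠ 0 := aeval_B_ne_zero_of_nondeg hP hnd
  exact Set.mem_biUnion (x := r) ⟨hrC, dyadicPt_of_onLevel hpt hBr⟩ hpt

/-- **`ThinFibreAt m₀ (A(Y) + x·B(Y))` for EVERY `m₀`** (`B` separable, `deg B ≥ 3`, `deg A ≤ deg B`, `A ⊥ B`),
HYPOTHESIS-FREE — the binder `3 ≤ m₀` of node 4's `thinFibreAt_xLinear_sep` REMOVED on this class. -/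
theorem thinFibreAt_xLinear_sep3 (A B : ℤ[X]) (hsep : (B.map (Int.castRingHom ℚ)).Separable) (hn : 3 ≤ B.natDegree)
    (hle : A.natDegree ≤ B.natDegree) (hcop : IsCoprime (A.map (Int.castRingHom ℚ)) (B.map (Int.castRingHom ℚ)))
    (m₀ : ℕ) : ThinFibreAt m₀ (xLinP A B) :=
  thinFibreAt_of_levelFinite (levelFinite_xLinear_sep3 A B hsep hn hle hcop) m₀

/-- union with node 2's `deg B < deg A` (tree `thinFibreAt_xLinear_of_lt`, hypothesis-free at `m₀ ≥ 2`):
**every x-linear curve with `B` separable of degree `≥ 3` and `A ⊥ B` has `ThinFibreAt m₀` for every `m₀ ≥ 2`.** -/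
theorem thinFibreAt_xLinear_sep3_or_lt (A B : ℤ[X]) (hsep : (B.map (Int.castRingHom ℚ)).Separable) (hn : 3 ≤ B.natDegree)
    (hcop : IsCoprime (A.map (Int.castRingHom ℚ)) (B.map (Int.castRingHom ℚ))) {m₀ : ℕ} (hm : 2 ≤ m₀) :
    ThinFibreAt m₀ (xLinP A B) := by
  rcases Nat.lt_or_ge B.natDegree A.natDegree with hlt | hle
  · have hB0 : B ≠ 0 := by rintro rfl; simp at hn
    exact thinFibreAt_xLinear_of_lt A B hB0 hlt hm
  · exact thinFibreAt_xLinear_sep3 A B hsep hn hle hcop m₀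

/-- [class] statement def (census convention): **the Thue–Mahler class** — `P = A(Y) + x·B(Y)` with `B` separable over `ℚ`
of degree `≥ 3`, `deg A ≤ deg B`, `A ⊥ B` in `ℚ[Y]` (no `m₀` enters). -/
def XLinTM (P : ℤ[X][X]) : Prop :=
  ∃ A B : ℤ[X], (B.map (Int.castRingHom ℚ)).Separable ∧ 3 ≤ B.natDegree ∧ A.natDegree ≤ B.natDegree ∧
    IsCoprime (A.map (Int.castRingHom ℚ)) (B.map (Int.castRingHom ℚ)) ∧ P = xLinP A B

/-- **`XLinTM P → LevelFinite P`**. -/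
theorem levelFinite_of_xLinTM {P : ℤ[X][X]} (h : XLinTM P) : LevelFinite P := by
  obtain ⟨A, B, hsep, hn, hle, hcop, rfl⟩ := h
  exact levelFinite_xLinear_sep3 A B hsep hn hle hcop

/-- **`XLinTM P → ThinFibreAt m₀ P` for EVERY `m₀`**, HYPOTHESIS-FREE. -/
theorem thinFibreAt_of_xLinTM {P : ℤ[X][X]} (h : XLinTM P) (m₀ : ℕ) : ThinFibreAt m₀ P :=
  thinFibreAt_of_levelFinite (levelFinite_of_xLinTM h) m₀

/-! ## §6  THE ODD-PART LEVER AT A LEVEL POINT, BY NAME (cite-token «Mahler1933»: K. Mahler, *Zur Approximation algebraischer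
Zahlen I: Über den größten Primteiler binärer Formen*, Math. Ann. 107 (1933) 691–730 — the reduction of `F(a,d) = ±2^e·o`, `o`
bounded, to `p`-adic Thue–Siegel; modern accounts: Evertse–Győry, *Unit Equations in Diophantine Number Theory* (2015) ch. 9
(Thue–Mahler equations ⇐ S-unit equations), Bombieri–Gubler, *Heights in Diophantine Geometry* (2006) §5.4, Shorey–Tijdeman (1986)
ch. 7.  NO problem-relative novelty is claimed for the number theory — only for the K-line reach.) -/

/-- every ODD divisor of `F_B` at a solution of `2^e·F_A + s·F_B = 0` is a common odd divisor of `F_A`, `F_B`, hence divides `d₀`. -/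
theorem odd_dvd_of_rel {F G s d₀ : ℤ} {e : ℕ} (hrel : (2 : ℤ) ^ e * G + s * F = 0)
    (hdiv : ∀ m : ℤ, Odd m → m ∣ G → m ∣ F → m ∣ d₀) : ∀ m : ℤ, Odd m → m ∣ F → m ∣ d₀ := by
  intro m hm hmF
  refine hdiv m hm ?_ hmF
  have h1 : m ∣ (2 : ℤ) ^ e * G := by
    have : (2 : ℤ) ^ e * G = -(s * F) := by linear_combination hrel
    rw [this]; exact (Dvd.dvd.mul_left hmF _).neg_right
  exact (isCoprime_two_pow_of_odd' hm e).dvd_of_dvd_mul_left h1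

/-- **THE LEVER AT A LEVEL POINT** (cite-token «Mahler1933»; tree `OnLevel`, `hform`): for `A ⊥ B` (`deg A ≤ n = deg B`,
with the resultant bound `d₀`) every ODD divisor of `F_B(num r, den r) = den(r)ⁿ·B(r)` at a level point `(s_N, r)`, `r ≠ 0`,
divides `d₀` (level identity `2^{N!}·F_A + p_N·F_B = 0`; NO parity of `p_N` is needed — an odd divisor of `F_B` is prime to
`2^{N!}`, hence divides `F_A`). -/
theorem odd_dvd_resultant_of_onLevel {A B : ℤ[X]} {d₀ : ℤ}
    (hres : ∀ u v : ℤ, u ≠ 0 → v ≠ 0 → IsCoprime u v →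
      ∀ m : ℤ, m ∣ hform A.coeff B.natDegree u v → m ∣ hform B.coeff B.natDegree u v → m ∣ d₀)
    (hle : A.natDegree ≤ B.natDegree) {N : ℕ} {r : ℚ} (h : OnLevel A B N r) (hBr : aeval r B ≠ 0) (hr0 : r ≠ 0) :
    ∀ m : ℤ, Odd m → m ∣ hform B.coeff B.natDegree r.num (r.den : ℤ) → m ∣ d₀ := by
  obtain ⟨-, s, e, -, hrel⟩ := dyadicPt_of_onLevel h hBr
  exact odd_dvd_of_rel (hform_rel hle le_rfl hrel) fun m _ hmA hmB =>
    hres r.num r.den (Rat.num_ne_zero.mpr hr0) (by exact_mod_cast r.den_nz) (isCoprime_num_den r) m hmA hmB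

end Summit.Schanuel.Schanuel.Theorems.RootDecomp1KThueMahler

end
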